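import Summits.QuantumFields.YangMills.Theorems.PoincareLipschitzLeungXinBoxCaccioppoli
import Summits.QuantumFields.YangMills.Theorems.PoincareLipschitzLeungXinTwistedGraphStability

/-!
# Crux `HistoryTailL` (stmt-QuantumFields-19936), K2 organ of record `hReg` = «LOC-REG-MIN» (route crux `PoincareLipschitz.BlockLipschitzL`,
# stmt-QuantumFields-23533): THE TWISTED STABILITY CACCIOPPOLI INEQUALITY ON BOXES OF `ℤ^d` — box cutoff + bond count over ★w8-19936 g6's
# `twisted_graph_stability_frob`: `E(Q_ρ) ≤ 6·2d(2(ρ+s)+1)^d·(1∕s² + τ²)` (`≍ R^{d−2} + θ²R^{d+2}` at `ρ = s = R`, `τ ≍ θR`) from minimality alone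

Cell `ym3-torus` (YM ladder rung R3 = continuum SU(2) Yang–Mills on the three-torus — a RUNG, NOT the Clay problem: not d = 4, not infinite
volume, not a mass gap), TWIN-WIDTH seat `ym-ust-19936-w7` gen 11 (LEAD `ym-ust-19936-w1` g8 DISPATCH 2026-08-29T04:55:44Z «★w7 g11: BOX CUTOFF +
TWIST SIZE — GO»); `--supports stmt-QuantumFields-19936 --as helper`; THEOREMS ONLY, definition-free; the sequel of ✓`…LeungXinBoxCaccioppoli` (flat),
whose letters (`dot_le_one`, `card_touching_box_le`, `sum_sq_sub_cutoff_le`, carrier `Zd d`, bonds `(y, μ) : y → y + e_μ`) it imports.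

WHY.  ★w8's `PoincareLipschitzLeungXinTwistedGraphStability.twisted_graph_stability_frob` is the TWISTED stability inequality on an abstract finite
graph: per-bond transports `S_b` (orthogonal `4×4`, acting on the target end by `(S_b)ᵀ`), `e_b = |u_x − (S_b)ᵀu_y|²`, `c_b = u_x·(S_b)ᵀu_y`, and for a
NON-NEGATIVE cutoff `η`: `Σ_b η_xη_y·e_b·(1 + e_b) ≤ 6·Σ_b [c_b(η_x − η_y)² + η_xη_y·‖S_b − 1‖_F²]`.  With lit ✓`exists_cutoff`'s `χ` between `Q_{ρ+1}(z)`
and `Q_{ρ+s}(z)` and the count `#{bonds touching Q_{ρ+s}(z)} ≤ 2d(2(ρ+s)+1)^d` (flat file), the gradient part is `≤ 2d(2(ρ+s)+1)^d∕s²` (`c_b ≤ 1`: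
`(S_b)ᵀu_y` is a unit vector) and the volume part is `≤ 2d(2(ρ+s)+1)^d·τ²` once `‖S_b − 1‖_F² ≤ τ²` on the bonds with both ends in `Q_{ρ+s}(z)` (the
others carry `χ_xχ_y = 0`).  So (`twisted_stability_caccioppoli_box`):

  `Σ_{b ∈ T, both ends in Q_ρ(z)} e_b·(1 + e_b) ≤ 6·(2d·(2(ρ+s)+1)^d)·(1∕s² + τ²)`,

and at `ρ = s = R` (`twisted_stability_caccioppoli_box_half`) `Σ e_b ≤ 12d(4R+1)^d(R⁻² + τ²)`.  READING (LEAD ruling 04:37:48Z): in a ball gauge where both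
fields' bonds are `O(θ_i R)`-close to `1`, LEAD's ✓∕⧗`PoincareLipschitzSU2SphereDictionary.exists_orthogonal_twist` gives `‖S_b − 1‖_F² ≤ 8(dist1 V_b² +
dist1 W_b²) ≲ θ_i²R²` (lit ✓`T4AxialGaugeSmallField.dist1_gaugeAct_axialGauge_le_of_mem_boxBonds` for the ball-gauge sizes), so `τ ≍ θ_iR` and
`E(Q_R) ≲ R^{d−2} + θ_i²R^{d+2}` — the bounded-normalised-energy input of the (discrete Schoen–Uhlenbeck) regularity step of `hReg`.  The hypothesis
`hmin` (every cutoff supported in `Q_{ρ+s}(z)`) is what box-ℓ²-orbit minimality of the relative gauge gives through the dictionary (`dist1_bond_sq_eq`,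
`exists_su2_coords_eq`) with `S b := R_bᵀ`, `R_b := exists_orthogonal_twist V_b W_b⁻¹` (then `S_b S_bᵀ = R_bᵀR_b = 1` verbatim).

WHAT (ns `…Theorems.PoincareLipschitzLeungXinBoxCaccioppoliTwisted`).
* `dot_transpose_mulVec_le_one` (`u·Sᵀv ≤ 1`), ★★★`twisted_stability_caccioppoli_box`, ★★`twisted_stability_caccioppoli_box_half`.
HONEST SCOPE.  An instantiation (cutoff + counting) of ★w8's inequality; nothing of `hReg`∕LOC-REG-MIN, the charts, `BlockLipschitzL`, `HistoryTailL` or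
any summit statement is proved; the energy→range step is NOT here.  YM₃ on T³ is rung R3, NOT the Clay problem.

References: Y. L. Xin, Duke Math. J. **47** (1980) 609–613 [Xin1980]; T. Kajigaya, Ann. Mat. Pura Appl. (2023) doi:10.1007∕s10231-023-01374-3, Thm 1.2;
M. Giaquinta [Giaquinta1984] Ch. III §2 p.77; T. Bałaban, Commun. Math. Phys. **98** (1985) 17–51 [Balaban1985Averaging] §3.
-/

set_option autoImplicit false

open scoped BigOperators
open Finset Matrix

namespace Summit.QuantumFields.YangMills.Theorems.PoincareLipschitzLeungXinBoxCaccioppoliTwisted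

open Literature.MathematicalPhysics.QuantumFieldTheory.Balaban1983to89.B4Eq19LatticeOperators
  (Zd unitVec box mem_box box_mono card_box)
open Literature.MathematicalPhysics.QuantumFieldTheory.Balaban1983to89.B4Eq19LatticeCaccioppoli (exists_cutoff)
open Summit.QuantumFields.YangMills.Theorems.PoincareLipschitzLeungXinTwistedGraphStability
  (transpose_mulVec_dot twisted_graph_stability_frob)
open Summit.QuantumFields.YangMills.Theorems.PoincareLipschitzLeungXinBoxCaccioppoli
  (dot_le_one card_touching_box_le sum_sq_sub_cutoff_le)

variable {d : ℕ}

/-! ## §1 The twisted stability Caccioppoli inequality on a box of `ℤ^d` -/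

/-- The twisted correlation weight is at most one: `u_x·((S_b)ᵀu_y) ≤ 1` for unit `u` and orthogonal `S_b`. [folklore] -/
theorem dot_transpose_mulVec_le_one {S : Matrix (Fin 4) (Fin 4) ℝ} (hS : S * Sᵀ = 1) {u v : Fin 4 → ℝ}
    (hu : dotProduct u u = 1) (hv : dotProduct v v = 1) : dotProduct u (Sᵀ *ᵥ v) ≤ 1 :=
  dot_le_one hu (by rw [transpose_mulVec_dot hS, hv])

/-- ★★★ **THE TWISTED STABILITY CACCIOPPOLI INEQUALITY ON A BOX OF `ℤ^d`.**  As `stability_caccioppoli_box`, with per-bond TWISTS `S_b` (orthogonal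
`4 × 4`, acting on the target end by `(S_b)ᵀ`; twisted point `q_b = (S_b)ᵀu_y`, `e_b = |u_x − q_b|²`): if the twisted correlation `Σ_{b∈T} u_x·(S_b)ᵀu_y`
is not increased by the Leung–Xin variations with cutoffs supported in `Q_{ρ+s}(z)` (★w8's `twisted_graph_stability_frob` hypothesis on `T`, for every
such cutoff), and the twists of the bonds with both ends in `Q_{ρ+s}(z)` satisfy `‖S_b − 1‖_F² ≤ τ²`, then
`Σ_{b ∈ T, both ends in Q_ρ(z)} e_b·(1 + e_b) ≤ 6·(2d·(2(ρ+s)+1)^d)·(1∕s² + τ²)` — at `ρ = s = R`, `τ ≍ θ·R` (ball gauge, the dictionary's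
`‖R_b − 1‖_F² ≤ 8(dist1 V_b² + dist1 W_b²)`): `E(Q_R) ≲ R^{d−2} + θ²R^{d+2}`, the LOC-REG-MIN programme's twisted display, from minimality alone.
[cite: Xin1980, p.609–613; Kajigaya 2023 Thm 1.2; Giaquinta1984, Ch. III §2 p.77] -/
theorem twisted_stability_caccioppoli_box (T : Finset (Zd d × Fin d)) (u : Zd d → Fin 4 → ℝ) (hu : ∀ x, dotProduct (u x) (u x) = 1)
    (S : Zd d × Fin d → Matrix (Fin 4) (Fin 4) ℝ) (hS : ∀ b ∈ T, S b * (S b)ᵀ = 1)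
    (z : Zd d) {ρ s : ℤ} (hρ : 0 ≤ ρ) (hs : 1 ≤ s) {τ : ℝ}
    (hτ : ∀ b ∈ T, b.1 ∈ box z (ρ + s) → b.1 + unitVec b.2 ∈ box z (ρ + s) →
      ∑ a : Fin 4, ∑ i : Fin 4, (S b a i - (1 : Matrix (Fin 4) (Fin 4) ℝ) a i) ^ 2 ≤ τ ^ 2)
    (hmin : ∀ η : Zd d → ℝ, (∀ y ∉ box z (ρ + s), η y = 0) → ∀ (a : Fin 4) (t : ℝ),
      ∑ b ∈ T, dotProduct
        ((Real.sqrt (1 + t ^ 2 * dotProduct (η b.1 • (Pi.single a 1 - dotProduct (Pi.single a 1) (u b.1) • u b.1))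
            (η b.1 • (Pi.single a 1 - dotProduct (Pi.single a 1) (u b.1) • u b.1))))⁻¹ •
          (u b.1 + t • (η b.1 • (Pi.single a 1 - dotProduct (Pi.single a 1) (u b.1) • u b.1))))
        ((S b)ᵀ *ᵥ ((Real.sqrt (1 + t ^ 2 * dotProduct (η (b.1 + unitVec b.2) •
              (Pi.single a 1 - dotProduct (Pi.single a 1) (u (b.1 + unitVec b.2)) • u (b.1 + unitVec b.2)))
            (η (b.1 + unitVec b.2) • (Pi.single a 1 - dotProduct (Pi.single a 1) (u (b.1 + unitVec b.2)) • u (b.1 + unitVec b.2)))))⁻¹ •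
          (u (b.1 + unitVec b.2) + t • (η (b.1 + unitVec b.2) •
            (Pi.single a 1 - dotProduct (Pi.single a 1) (u (b.1 + unitVec b.2)) • u (b.1 + unitVec b.2)))))) ≤
      ∑ b ∈ T, dotProduct (u b.1) ((S b)ᵀ *ᵥ u (b.1 + unitVec b.2))) :
    ∑ b ∈ T.filter (fun b => b.1 ∈ box z ρ ∧ b.1 + unitVec b.2 ∈ box z ρ),
      dotProduct (u b.1 - (S b)ᵀ *ᵥ u (b.1 + unitVec b.2)) (u b.1 - (S b)ᵀ *ᵥ u (b.1 + unitVec b.2)) *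
        (1 + dotProduct (u b.1 - (S b)ᵀ *ᵥ u (b.1 + unitVec b.2)) (u b.1 - (S b)ᵀ *ᵥ u (b.1 + unitVec b.2))) ≤
      6 * (2 * (d : ℝ) * ((2 * (ρ + s) + 1 : ℤ) : ℝ) ^ d) * (1 / (s : ℝ) ^ 2 + τ ^ 2) := by
  classical
  obtain ⟨χ, hχ0, hχ1, hχin, hχout, hχlip⟩ := exists_cutoff z hρ hs
  -- ★w8's twisted inequality on the finite graph `T` (as a type) with the cutoff `χ`
  have hG := twisted_graph_stability_frob (B := ↥T) (fun b => b.1.1) (fun b => b.1.1 + unitVec b.1.2) u hu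
    (fun b => S b.1) (fun b => hS b.1 b.2) χ hχ0 (fun a t => by
    have h := hmin χ hχout a t
    rw [← Finset.sum_coe_sort T] at h
    rw [← Finset.sum_coe_sort T] at h
    exact h)
  rw [Finset.sum_coe_sort T (fun b => χ b.1 * χ (b.1 + unitVec b.2) *
      dotProduct (u b.1 - (S b)ᵀ *ᵥ u (b.1 + unitVec b.2)) (u b.1 - (S b)ᵀ *ᵥ u (b.1 + unitVec b.2)) *
        (1 + dotProduct (u b.1 - (S b)ᵀ *ᵥ u (b.1 + unitVec b.2)) (u b.1 - (S b)ᵀ *ᵥ u (b.1 + unitVec b.2)))),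
    Finset.sum_coe_sort T (fun b => dotProduct (u b.1) ((S b)ᵀ *ᵥ u (b.1 + unitVec b.2)) * (χ b.1 - χ (b.1 + unitVec b.2)) ^ 2 +
      χ b.1 * χ (b.1 + unitVec b.2) * ∑ a : Fin 4, ∑ i : Fin 4, (S b a i - (1 : Matrix (Fin 4) (Fin 4) ℝ) a i) ^ 2)] at hG
  -- nonnegativity of the energy terms
  have he0 : ∀ b : Zd d × Fin d, 0 ≤ dotProduct (u b.1 - (S b)ᵀ *ᵥ u (b.1 + unitVec b.2)) (u b.1 - (S b)ᵀ *ᵥ u (b.1 + unitVec b.2)) :=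
    fun b => by
    simp only [dotProduct, Pi.sub_apply]
    exact Finset.sum_nonneg fun i _ => mul_self_nonneg _
  have hterm0 : ∀ b : Zd d × Fin d, 0 ≤ dotProduct (u b.1 - (S b)ᵀ *ᵥ u (b.1 + unitVec b.2)) (u b.1 - (S b)ᵀ *ᵥ u (b.1 + unitVec b.2)) *
      (1 + dotProduct (u b.1 - (S b)ᵀ *ᵥ u (b.1 + unitVec b.2)) (u b.1 - (S b)ᵀ *ᵥ u (b.1 + unitVec b.2))) := fun b =>
    mul_nonneg (he0 b) (by linarith [he0 b])
  -- LEFT: the bonds inside `Q_ρ(z)` carry `χ_x χ_y = 1`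
  have hρ1 : box z ρ ⊆ box z (ρ + 1) := box_mono z (by linarith)
  have hL : ∑ b ∈ T.filter (fun b => b.1 ∈ box z ρ ∧ b.1 + unitVec b.2 ∈ box z ρ),
      dotProduct (u b.1 - (S b)ᵀ *ᵥ u (b.1 + unitVec b.2)) (u b.1 - (S b)ᵀ *ᵥ u (b.1 + unitVec b.2)) *
        (1 + dotProduct (u b.1 - (S b)ᵀ *ᵥ u (b.1 + unitVec b.2)) (u b.1 - (S b)ᵀ *ᵥ u (b.1 + unitVec b.2))) ≤
      ∑ b ∈ T, χ b.1 * χ (b.1 + unitVec b.2) *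
        dotProduct (u b.1 - (S b)ᵀ *ᵥ u (b.1 + unitVec b.2)) (u b.1 - (S b)ᵀ *ᵥ u (b.1 + unitVec b.2)) *
          (1 + dotProduct (u b.1 - (S b)ᵀ *ᵥ u (b.1 + unitVec b.2)) (u b.1 - (S b)ᵀ *ᵥ u (b.1 + unitVec b.2))) := by
    calc ∑ b ∈ T.filter (fun b => b.1 ∈ box z ρ ∧ b.1 + unitVec b.2 ∈ box z ρ),
          dotProduct (u b.1 - (S b)ᵀ *ᵥ u (b.1 + unitVec b.2)) (u b.1 - (S b)ᵀ *ᵥ u (b.1 + unitVec b.2)) *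
            (1 + dotProduct (u b.1 - (S b)ᵀ *ᵥ u (b.1 + unitVec b.2)) (u b.1 - (S b)ᵀ *ᵥ u (b.1 + unitVec b.2)))
        = ∑ b ∈ T.filter (fun b => b.1 ∈ box z ρ ∧ b.1 + unitVec b.2 ∈ box z ρ), χ b.1 * χ (b.1 + unitVec b.2) *
            dotProduct (u b.1 - (S b)ᵀ *ᵥ u (b.1 + unitVec b.2)) (u b.1 - (S b)ᵀ *ᵥ u (b.1 + unitVec b.2)) *
              (1 + dotProduct (u b.1 - (S b)ᵀ *ᵥ u (b.1 + unitVec b.2)) (u b.1 - (S b)ᵀ *ᵥ u (b.1 + unitVec b.2))) := by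
          refine Finset.sum_congr rfl fun b hb => ?_
          obtain ⟨_, hb1, hb2⟩ := Finset.mem_filter.1 hb
          rw [hχin _ (hρ1 hb1), hχin _ (hρ1 hb2), one_mul, one_mul]
      _ ≤ _ := by
          refine Finset.sum_le_sum_of_subset_of_nonneg (Finset.filter_subset _ T) fun b _ _ => ?_
          rw [mul_assoc]
          exact mul_nonneg (mul_nonneg (hχ0 _) (hχ0 _)) (hterm0 b)
  -- RIGHT, gradient part: `c_b ≤ 1` and the cutoff's capacity
  have hR1 : ∑ b ∈ T, dotProduct (u b.1) ((S b)ᵀ *ᵥ u (b.1 + unitVec b.2)) * (χ b.1 - χ (b.1 + unitVec b.2)) ^ 2 ≤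
      2 * (d : ℝ) * ((2 * (ρ + s) + 1 : ℤ) : ℝ) ^ d / (s : ℝ) ^ 2 :=
    sum_sq_sub_cutoff_le T z (by linarith) hs hχout hχlip (fun b => dotProduct (u b.1) ((S b)ᵀ *ᵥ u (b.1 + unitVec b.2)))
      (fun b hb => dot_transpose_mulVec_le_one (hS b hb) (hu _) (hu _))
  -- RIGHT, volume part: only bonds with both ends in `Q_{ρ+s}(z)` carry `χ_xχ_y ≠ 0`, and there `χ_xχ_y ≤ 1`, `‖S_b − 1‖_F² ≤ τ²`
  have hR2 : ∑ b ∈ T, χ b.1 * χ (b.1 + unitVec b.2) * ∑ a : Fin 4, ∑ i : Fin 4, (S b a i - (1 : Matrix (Fin 4) (Fin 4) ℝ) a i) ^ 2 ≤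
      2 * (d : ℝ) * ((2 * (ρ + s) + 1 : ℤ) : ℝ) ^ d * τ ^ 2 := by
    have hF0 : ∀ b : Zd d × Fin d, 0 ≤ ∑ a : Fin 4, ∑ i : Fin 4, (S b a i - (1 : Matrix (Fin 4) (Fin 4) ℝ) a i) ^ 2 := fun b =>
      Finset.sum_nonneg fun a _ => Finset.sum_nonneg fun i _ => sq_nonneg _
    rw [← Finset.sum_filter_add_sum_filter_not T (fun b => b.1 ∈ box z (ρ + s) ∨ b.1 + unitVec b.2 ∈ box z (ρ + s))]
    have hzero : ∑ b ∈ T.filter (fun b => ¬(b.1 ∈ box z (ρ + s) ∨ b.1 + unitVec b.2 ∈ box z (ρ + s))),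
        χ b.1 * χ (b.1 + unitVec b.2) * ∑ a : Fin 4, ∑ i : Fin 4, (S b a i - (1 : Matrix (Fin 4) (Fin 4) ℝ) a i) ^ 2 = 0 := by
      refine Finset.sum_eq_zero fun b hb => ?_
      rw [Finset.mem_filter, not_or] at hb
      rw [hχout _ hb.2.1, zero_mul, zero_mul]
    rw [hzero, add_zero]
    have hterm : ∀ b ∈ T.filter (fun b => b.1 ∈ box z (ρ + s) ∨ b.1 + unitVec b.2 ∈ box z (ρ + s)),
        χ b.1 * χ (b.1 + unitVec b.2) * ∑ a : Fin 4, ∑ i : Fin 4, (S b a i - (1 : Matrix (Fin 4) (Fin 4) ℝ) a i) ^ 2 ≤ τ ^ 2 := by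
      intro b hb
      have hbT := (Finset.mem_filter.1 hb).1
      by_cases hboth : b.1 ∈ box z (ρ + s) ∧ b.1 + unitVec b.2 ∈ box z (ρ + s)
      · have hF := hτ b hbT hboth.1 hboth.2
        have hχχ : χ b.1 * χ (b.1 + unitVec b.2) ≤ 1 := by
          calc χ b.1 * χ (b.1 + unitVec b.2) ≤ 1 * 1 := mul_le_mul (hχ1 _) (hχ1 _) (hχ0 _) zero_le_one
            _ = 1 := one_mul 1
        calc χ b.1 * χ (b.1 + unitVec b.2) * ∑ a : Fin 4, ∑ i : Fin 4, (S b a i - (1 : Matrix (Fin 4) (Fin 4) ℝ) a i) ^ 2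
            ≤ 1 * τ ^ 2 := mul_le_mul hχχ hF (hF0 b) zero_le_one
          _ = τ ^ 2 := one_mul _
      · -- one endpoint is off the box: `χ` vanishes there
        rw [not_and_or] at hboth
        rcases hboth with h1 | h2
        · rw [hχout _ h1, zero_mul, zero_mul]; exact sq_nonneg τ
        · rw [hχout _ h2, mul_zero, zero_mul]; exact sq_nonneg τ
    calc ∑ b ∈ T.filter (fun b => b.1 ∈ box z (ρ + s) ∨ b.1 + unitVec b.2 ∈ box z (ρ + s)),
          χ b.1 * χ (b.1 + unitVec b.2) * ∑ a : Fin 4, ∑ i : Fin 4, (S b a i - (1 : Matrix (Fin 4) (Fin 4) ℝ) a i) ^ 2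
        ≤ ∑ _b ∈ T.filter (fun b => b.1 ∈ box z (ρ + s) ∨ b.1 + unitVec b.2 ∈ box z (ρ + s)), τ ^ 2 := Finset.sum_le_sum hterm
      _ = ((T.filter fun b => b.1 ∈ box z (ρ + s) ∨ b.1 + unitVec b.2 ∈ box z (ρ + s)).card : ℝ) * τ ^ 2 := by
          rw [Finset.sum_const, nsmul_eq_mul]
      _ ≤ 2 * (d : ℝ) * ((2 * (ρ + s) + 1 : ℤ) : ℝ) ^ d * τ ^ 2 :=
          mul_le_mul_of_nonneg_right (card_touching_box_le T z (by linarith)) (sq_nonneg τ)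
  rw [Finset.sum_add_distrib] at hG
  calc _ ≤ _ := hL
    _ ≤ _ := hG
    _ ≤ 6 * (2 * (d : ℝ) * ((2 * (ρ + s) + 1 : ℤ) : ℝ) ^ d / (s : ℝ) ^ 2 + 2 * (d : ℝ) * ((2 * (ρ + s) + 1 : ℤ) : ℝ) ^ d * τ ^ 2) := by
        linarith
    _ = 6 * (2 * (d : ℝ) * ((2 * (ρ + s) + 1 : ℤ) : ℝ) ^ d) * (1 / (s : ℝ) ^ 2 + τ ^ 2) := by ring

/-- ★★ **The half-box twisted form** (`ρ = s = R ≥ 1`): `Σ_{T ∩ Q_R-bonds} e_b ≤ 12·d·(4R+1)^d·(1∕R² + τ²)` under minimality against variations supported in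
`Q_{2R}(z)` and `‖S_b − 1‖_F² ≤ τ²` there — with `τ ≍ θR`: `E(Q_R) ≲ R^{d−2} + θ²R^{d+2}` (`e_b ≤ e_b(1+e_b)`).
[cite: Xin1980, p.609–613; Giaquinta1984, Ch. III §2 p.77] -/
theorem twisted_stability_caccioppoli_box_half (T : Finset (Zd d × Fin d)) (u : Zd d → Fin 4 → ℝ)
    (hu : ∀ x, dotProduct (u x) (u x) = 1)
    (S : Zd d × Fin d → Matrix (Fin 4) (Fin 4) ℝ) (hS : ∀ b ∈ T, S b * (S b)ᵀ = 1)
    (z : Zd d) {R : ℤ} (hR : 1 ≤ R) {τ : ℝ}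
    (hτ : ∀ b ∈ T, b.1 ∈ box z (R + R) → b.1 + unitVec b.2 ∈ box z (R + R) →
      ∑ a : Fin 4, ∑ i : Fin 4, (S b a i - (1 : Matrix (Fin 4) (Fin 4) ℝ) a i) ^ 2 ≤ τ ^ 2)
    (hmin : ∀ η : Zd d → ℝ, (∀ y ∉ box z (R + R), η y = 0) → ∀ (a : Fin 4) (t : ℝ),
      ∑ b ∈ T, dotProduct
        ((Real.sqrt (1 + t ^ 2 * dotProduct (η b.1 • (Pi.single a 1 - dotProduct (Pi.single a 1) (u b.1) • u b.1))
            (η b.1 • (Pi.single a 1 - dotProduct (Pi.single a 1) (u b.1) • u b.1))))⁻¹ •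
          (u b.1 + t • (η b.1 • (Pi.single a 1 - dotProduct (Pi.single a 1) (u b.1) • u b.1))))
        ((S b)ᵀ *ᵥ ((Real.sqrt (1 + t ^ 2 * dotProduct (η (b.1 + unitVec b.2) •
              (Pi.single a 1 - dotProduct (Pi.single a 1) (u (b.1 + unitVec b.2)) • u (b.1 + unitVec b.2)))
            (η (b.1 + unitVec b.2) • (Pi.single a 1 - dotProduct (Pi.single a 1) (u (b.1 + unitVec b.2)) • u (b.1 + unitVec b.2)))))⁻¹ •
          (u (b.1 + unitVec b.2) + t • (η (b.1 + unitVec b.2) •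
            (Pi.single a 1 - dotProduct (Pi.single a 1) (u (b.1 + unitVec b.2)) • u (b.1 + unitVec b.2)))))) ≤
      ∑ b ∈ T, dotProduct (u b.1) ((S b)ᵀ *ᵥ u (b.1 + unitVec b.2))) :
    ∑ b ∈ T.filter (fun b => b.1 ∈ box z R ∧ b.1 + unitVec b.2 ∈ box z R),
      dotProduct (u b.1 - (S b)ᵀ *ᵥ u (b.1 + unitVec b.2)) (u b.1 - (S b)ᵀ *ᵥ u (b.1 + unitVec b.2)) ≤
      12 * (d : ℝ) * ((4 * R + 1 : ℤ) : ℝ) ^ d * (1 / (R : ℝ) ^ 2 + τ ^ 2) := by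
  classical
  have h := twisted_stability_caccioppoli_box T u hu S hS z (ρ := R) (s := R) (by linarith) hR hτ hmin
  have he0 : ∀ b : Zd d × Fin d, 0 ≤ dotProduct (u b.1 - (S b)ᵀ *ᵥ u (b.1 + unitVec b.2)) (u b.1 - (S b)ᵀ *ᵥ u (b.1 + unitVec b.2)) :=
    fun b => by
    simp only [dotProduct, Pi.sub_apply]
    exact Finset.sum_nonneg fun i _ => mul_self_nonneg _
  have h1 : ∑ b ∈ T.filter (fun b => b.1 ∈ box z R ∧ b.1 + unitVec b.2 ∈ box z R),
      dotProduct (u b.1 - (S b)ᵀ *ᵥ u (b.1 + unitVec b.2)) (u b.1 - (S b)ᵀ *ᵥ u (b.1 + unitVec b.2)) ≤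
      ∑ b ∈ T.filter (fun b => b.1 ∈ box z R ∧ b.1 + unitVec b.2 ∈ box z R),
        dotProduct (u b.1 - (S b)ᵀ *ᵥ u (b.1 + unitVec b.2)) (u b.1 - (S b)ᵀ *ᵥ u (b.1 + unitVec b.2)) *
          (1 + dotProduct (u b.1 - (S b)ᵀ *ᵥ u (b.1 + unitVec b.2)) (u b.1 - (S b)ᵀ *ᵥ u (b.1 + unitVec b.2))) := by
    refine Finset.sum_le_sum fun b _ => ?_
    have := he0 b
    nlinarith
  have h2 : ((2 * (R + R) + 1 : ℤ) : ℝ) = ((4 * R + 1 : ℤ) : ℝ) := by push_cast; ring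
  rw [h2] at h
  have hτ0 : 0 ≤ 1 / (R : ℝ) ^ 2 + τ ^ 2 := by positivity
  calc _ ≤ _ := h1
    _ ≤ 6 * (2 * (d : ℝ) * ((4 * R + 1 : ℤ) : ℝ) ^ d) * (1 / (R : ℝ) ^ 2 + τ ^ 2) := h
    _ = 12 * (d : ℝ) * ((4 * R + 1 : ℤ) : ℝ) ^ d * (1 / (R : ℝ) ^ 2 + τ ^ 2) := by ring


end Summit.QuantumFields.YangMills.Theorems.PoincareLipschitzLeungXinBoxCaccioppoliTwisted
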